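import Summits.AtomisticToContinuum.Crystallization.Theorems.FrustratedLawDichotomyStrainedPatchHomSplit

/-!
# The strained-patch piece `F1X∪T(0)` cut by the CLEAN-COLLAR RADIUS: elastic textures ∧ defective collars, with the base-range bridge

Lens-5 g45 node «CleanCollar» (finite/base range + asymptotic regime + bridge) on the 27623 T-side piece `StrainedPatchRec`
(= `F1X∪T(0)`, `…StrainedPatchHomSplit.strainedPatch_iff`; float minimiser RD_jz0w52s, `S = +1.8209e-3`, g43/g44).

DOCTRINE DEFECT REPAIRED.  GEN 43H cut the piece as `HomFloor m ∧ TextureReliefBound L B` (seam `L·σ₁ + B ≤ m`); given the floor, (R) is the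
piece at the RAISED threshold `m − (L·σ₁ + B)` — not weaker than the target — and it quantifies over EVERY admissible cluster, clean or defective,
although its mechanism (linear response of a force-capped elastic texture) only speaks about clean 12-coordinated textures (g44 NODE §6).  This node
cuts the TARGET ITSELF, exhaustively (`em`) and by a LOCAL DECIDABLE predicate, into RESTRICTIONS (each WEAKER, necessity proved) along the boundary
of validity of the elastic description, and only then hangs (H)/(R) under the clean restriction:

* DIAL `r` = the clean-collar radius.  `CleanBall r z c` := every site within `r` of the centre is `1/8`-good at capped fit scale `3/2` (the members'
  own standard: `Admissible ⇒ CleanBall (9/5)`, `cleanBall_members`; `CleanBall ρ ↔ ¬BadNearCap ρ (3/2)`).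
* `CleanTextureFloor r` **[ELASTIC side]** — the piece on clusters with `CleanBall r`;  `DefectiveCollarFloor r` **[DEFECT side]** — the piece on
  clusters with `¬CleanBall r` (SOME site within `r` is not `1/8`-good: a vacancy shell, an over-coordinated site, a polytetrahedral / amorphous seam,
  a grossly sheared shell);  `AnnularDefectFloor r₁ r₂` — clean within `r₁`, a defect within `r₂`.
* EXACT CUT `StrainedPatchRec ↔ CleanTextureFloor r ∧ DefectiveCollarFloor r` (every `r`), both pieces WEAKER, monotone in the dial, endpoints
  `CleanTextureFloor (9/5) ↔ StrainedPatchRec`, `DefectiveCollarFloor (9/5)` trivial; LADDER `CleanTextureFloor r₁ ↔ CleanTextureFloor r₂ ∧ Annular r₁ r₂`,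
  `DefectiveCollarFloor r₂ ↔ DefectiveCollarFloor r₁ ∧ Annular r₁ r₂` (`r₁ ≤ r₂`): moving the dial costs exactly the annular piece.  [all PROVED]
* THREE REGIMES of record `StrainedPatchRec ↔ CleanTextureFloor (63/10) ∧ AnnularDefectFloor (24/5) (63/10) ∧ DefectiveCollarFloor (24/5)` with the
  dials `63/10 = 9/5 + 9/2` (members + range of `W₄₅` = the domain of dependence of the functional) and `24/5 = 9/5 + 3` (members + the LJ-core
  range of `W₄₅`; beyond it only the C¹ splice window `3 ≤ r < 9/2`, `W₄₅ = V·(1 − S₁((r−3)/(3/2))) ∈ [V 3, 0)`, `|W₄₅| ≤ 2.28e-4`, touches a member):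
  ELASTIC (clean on the whole domain of dependence: rigidity + Cauchy–Born + force cap) ∧ FAR-DEFECT (clean core of radius `24/5`, defect in the
  splice annulus: perturbative) ∧ NEAR-DEFECT (a defect inside `24/5`: defect energetics).  [PROVED]
* SECOND LAYER under the clean side (GEN 43H re-hung where its mechanism lives): `CleanTextureRelief r L B` = (R) restricted to clean clusters;
  `HomFloor m → CleanTextureRelief r L B → L·σ₁ + B ≤ m → CleanTextureFloor r`; `TextureReliefBound L B → CleanTextureRelief r L B` (nothing of GEN 43H
  is lost; the (H) certificate programme HomPruned / HomCover / HomWitness(Hcp) is untouched and still discharges `HomFloor (1/625)`).  [PROVED]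
* BRIDGE AT THE BASE RANGE (§7, the lens's typed bridge): split `x_j` into the CORE part and `tailOut R` (pair terms with sites beyond `R` of the
  centre); `CleanCoreFloor R μ` (core functional `≥ μ` on clean cores) ∧ `TailPenalty R μ` (far pair terms `≥ −μ`, a packing / window bound) ⟹
  `CleanTextureFloor R` = ELASTIC ∧ FAR-DEFECT (seam = additivity of `ballAvg`).  [PROVED]
* GEOMETRIC STRENGTHENING of the defect side (§8; critic ROW 783 (3)(b) «Admissible → NearHom ε» in decidable form, optional, UNDECIDED):
  `AdmissibleForcesClean r` (every admissible cluster is clean within `r`; no average, no tube parameter) makes `DefectiveCollarFloor r` vacuous;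
  `CleanTextureFloor (63/10) → AdmissibleForcesClean (24/5) → AnnularDefectFloor (24/5) (63/10) → StrainedPatchRec`.  [PROVED]
* RECORD NODES: `HomFloor (1/625) → CleanTextureRelief (63/10) (1/12) (1/4000) → AnnularDefectFloor (24/5) (63/10) → DefectiveCollarFloor (24/5) → F1X∪T(0)`
  and `CleanCoreFloor (24/5) (1/1000) → TailPenalty (24/5) (1/1000) → DefectiveCollarFloor (24/5) → F1X∪T(0)` (+ two-piece and milli variants).  [PROVED]

MEASURED (pure python, g45 `out/`; the lens's question «how far must the finite range reach for the bridge to bite»).  (a) CLEAN CENSUS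
(`census_*.jsonl`, 44 states): ALL 23 ADMISSIBLE states on file — the record minimiser RD_jz0w52s and its variants, the homogeneous floor
instances HZ00 / FZ00, every exactly restored kicked texture of g44's basin search, g43's fcc / torsion / soft-mode end states — are CLEAN at
`r = 63/10` (all `≈ 1 600` sites within `63/10` are clean 12-shells with misfit `< 1/8`; `η ∈ [.0505, .0530]` on the record, `≤ .103` overall): the
ELASTIC piece carries the knife-edge `+1.82e-3` and every admissible number the line has produced, the DEFECT pieces have no admissible instance on
file; every DEFECTIVE end state on file (g44: displaced / dense glass collars, vacancy, interstitials, crowdions; nearest non-clean site at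
`r_clean ≤ 3.9`, 36–1 574 non-clean sites) is inadmissible at tolerance `0`, visibly so in one column: each has 11–351 `1/20`-TIGHT sites — the defect
un-strains its neighbours (exempt) — besides the non-equilibrium cores of g44 §3–4; the ε_T = 10⁻⁴ kill textures of g43 (z‴) are CLEAN as well.  (b) RADIAL WEIGHT (`tailsplit_*.json`): the members' average splits as `S = +0.710 (−e_W) − 0.69816 (pairs r < 3) − 0.01002
(splice window)`; the part carried by sites beyond `R` of the centre is `−1.96e-2 / −4.04e-3 / −5.23e-4 / −1.67e-5 / 0` at `R = 3.3 / 4.05 / 24/5 /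
5.55 / 63/10` (record; hom instances the same to 2 digits): beyond `24/5` the far sites carry `29 %` of the margin — a perturbative budget —, inside
`4.05` they carry `2.2×` the margin — no bridge.  (c) UNRELAXED VACANCY INFLUENCE (`census_RD_jz0w52s.json`): removing any one of the 1 576
non-member reach sites RAISES the average (`W₄₅ < 0` on `(0.891, 9/2)`; `ΔS = +6.0e-3` at `r ≈ 1.9`, `+3.3e-4` at `3.1`, `+2.4e-5` at `4.1`, `< 6e-6`
beyond `24/5`); adding an atom inside the reach is removal-unstable (g44 §4) and an unrelaxed octahedral interstitial violates `Sep (7/10)` outright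
(hole radius `d/√2 ≤ 0.70` for `d ≤ 0.99`).  (d) INSTRUMENT ε_adm (critic ROW 783 (3); `nearhom45.py`, `out/NEARHOM.md`): the record minimiser is the ADMISSIBLE
cap-riding hcp floor instance HZ00 displaced by at most `2.53e-3` on the `63/10`-ball (relief `2.54e-4`); every admissible state on file is within `ε* ≤ 1.5e-2` of an
affine fcc / hcp configuration except two torsion textures (`ε* ≤ 0.061`, `S ≥ 3.05e-3`), and every state with NEGATIVE relief lies within `ε* ≤ 4e-3` of its homogeneous
reference: inside the ELASTIC piece the knife-edge lives in a tube of radius `≈ 4e-3` around the homogeneous instances (g46 candidate refinement «HomTube», g45 memo §5 6).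

TAGS.  ELASTIC `CleanTextureFloor (63/10)`: WEAKER · MECHANISM-NAMED (certified homogeneous floor + force-capped linear response; relief law
`L_meas = .022`, g43) · knife-edge.  FAR-DEFECT `AnnularDefectFloor (24/5) (63/10)`: WEAKER · PERTURBATIVE-CANDIDATE via §7 (`TailPenalty (24/5) (1/1000)`
tolerates a `1.9×` densification of the far annulus; `CleanCoreFloor (24/5) (1/1000)` has float value `2.34e-3` on the record core, `2.60e-3` on the
hcp floor core).  NEAR-DEFECT `DefectiveCollarFloor (24/5)`: WEAKER · UNDECIDED · evidence one-sided (every defect family rises and leaves `Admissible`);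
adversary of record = a converged polytetrahedral / amorphous collar inside `24/5` (census ASK).

HONESTY.  The cut is a case split, not a mechanism: its content is WHERE it cuts, so that the clean side is attackable by (H) + Cauchy–Born transfer
(+ the §7 tail budget) and the defect side by defect energetics — two different engines; neither piece, nor (H) ∧ clean relief, nor the annulus, nor
the core floor or the tail budget alone gives the target or another piece, and the geometric strengthening is neither provable nor
refutable in scope (must-fail probes `g45/check/CleanCollarProbes.lean`, 16/16).  No new
axioms (`[propext, Classical.choice, Quot.sound]`), no sorry, no cite tokens, no instances / notation.
Evidence: `run/shared/lean/pub/decomp-a2c/decomp-a2c-lens-5/g45/{NODE-g45.md, out/, scripts/, check/}`.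
-/

namespace Summit.AtomisticToContinuum.Crystallization.Theorems.FrustratedLawDichotomyStrainedPatchCleanCollar

open scoped BigOperators Classical
open Summit.AtomisticToContinuum.Crystallization.Theorems.FrustratedLawDichotomyRangeCut
open Summit.AtomisticToContinuum.Crystallization.Theorems.FrustratedLawDichotomySchurCut
open Summit.AtomisticToContinuum.Crystallization.Theorems.FrustratedLawDichotomyMotifLemmas
open Summit.AtomisticToContinuum.Crystallization.Theorems.FrustratedLawDichotomyAveragingCut
open Summit.AtomisticToContinuum.Crystallization.Theorems.FrustratedLawDichotomyAveragingRuleCap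
open Summit.AtomisticToContinuum.Crystallization.Theorems.FrustratedLawDichotomyAveragingRuleTightFree
open Summit.AtomisticToContinuum.Crystallization.Theorems.FrustratedLawDichotomyExemptDoor (SitePred)
open Summit.AtomisticToContinuum.Crystallization.Theorems.FrustratedLawDichotomyExemptAbsorption
open Summit.AtomisticToContinuum.Crystallization.Theorems.FrustratedLawDichotomyExemptAbsorptionRecord
open Summit.AtomisticToContinuum.Crystallization.Theorems.FrustratedLawDichotomyCollarCensus
open Summit.AtomisticToContinuum.Crystallization.Theorems.FrustratedLawDichotomyCollarCensusKappa
open Summit.AtomisticToContinuum.Crystallization.Theorems.FrustratedLawDichotomyStrainedPatchHomSplit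

/-! ## §1. The dial: the clean-collar radius -/

/-- **`CleanBall r z c`** — every site within `r` of the centre `z c` is `1/8`-good at capped fit scale `3/2` (a clean, at most
`1/8`-misfit, fcc- or hcp-like 12-shell with a clean gap below `13/10` of its nearest-neighbour distance). Local and decidable from the
positions within `r + 2` of the centre. -/
def CleanBall (r : ℝ) {M : ℕ} (z : Fin M → E3) (c : Fin M) : Prop :=
  ∀ a : Fin M, dist (z a) (z c) ≤ r → GoodAtScale (1 / 8) (3 / 2) z a

/-- `CleanBall` is antitone in the radius. [formal bookkeeping] -/
theorem CleanBall.mono {r r' : ℝ} {M : ℕ} {z : Fin M → E3} {c : Fin M} (h : CleanBall r' z c) (hle : r ≤ r') : CleanBall r z c :=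
  fun a ha => h a (ha.trans hle)

/-- `CleanBall ρ` is literally `¬BadNearCap ρ (3/2)`. [formal bookkeeping] -/
theorem cleanBall_iff_not_badNearCap {ρ : ℝ} {M : ℕ} {z : Fin M → E3} {c : Fin M} : CleanBall ρ z c ↔ ¬BadNearCap ρ (3 / 2) z c := by
  simp [CleanBall, BadNearCap, mem_ball]

/-- The members' own standard: an admissible cluster is clean within `9/5` (`Admissible` carries `¬BadNearCap (9/5) (3/2)`). [formal bookkeeping] -/
theorem cleanBall_members {M : ℕ} {z : Fin M → E3} {c : Fin M} (h : Admissible M z c) : CleanBall (9 / 5) z c :=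
  cleanBall_iff_not_badNearCap.2 h.2.2.2.2.2

/-! ## §2. The two pieces and the exact cut -/

/-- **`CleanTextureFloor r` [special side; ELASTIC regime]** — the piece restricted to clusters clean within `r` of the centre. -/
def CleanTextureFloor (r : ℝ) : Prop :=
  ∀ (M : ℕ) (z : Fin M → E3) (c : Fin M), Admissible M z c → CleanBall r z c → 0 ≤ ballAvg (9 / 5) z (xRec M z) c

/-- **`DefectiveCollarFloor r` [general side; DEFECT regime]** — the piece restricted to clusters with a non-`1/8`-good site within `r`. -/
def DefectiveCollarFloor (r : ℝ) : Prop :=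
  ∀ (M : ℕ) (z : Fin M → E3) (c : Fin M), Admissible M z c → ¬CleanBall r z c → 0 ≤ ballAvg (9 / 5) z (xRec M z) c

/-- ★ **EXACT CUT** (every dial value): `StrainedPatchRec ↔ CleanTextureFloor r ∧ DefectiveCollarFloor r`. [folklore: `em` on `CleanBall r`] -/
theorem strainedPatchRec_iff_clean_and_defective (r : ℝ) : StrainedPatchRec ↔ CleanTextureFloor r ∧ DefectiveCollarFloor r := by
  refine ⟨fun h => ⟨fun M z c hz _ => h M z c hz, fun M z c hz _ => h M z c hz⟩, fun h M z c hz => ?_⟩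
  by_cases hcl : CleanBall r z c
  · exact h.1 M z c hz hcl
  · exact h.2 M z c hz hcl

/-- NECESSITY: the clean piece is WEAKER than the target (a restriction). [folklore] -/
theorem cleanTextureFloor_of_strainedPatch (r : ℝ) (h : StrainedPatchRec) : CleanTextureFloor r :=
  ((strainedPatchRec_iff_clean_and_defective r).1 h).1

/-- NECESSITY: the defective piece is WEAKER than the target (a restriction). [folklore] -/
theorem defectiveCollarFloor_of_strainedPatch (r : ℝ) (h : StrainedPatchRec) : DefectiveCollarFloor r :=
  ((strainedPatchRec_iff_clean_and_defective r).1 h).2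

/-- SEAM: the two pieces give the target. [folklore] -/
theorem strainedPatchRec_of_clean_of_defective {r : ℝ} (hC : CleanTextureFloor r) (hD : DefectiveCollarFloor r) : StrainedPatchRec :=
  (strainedPatchRec_iff_clean_and_defective r).2 ⟨hC, hD⟩

/-! ## §3. Monotonicity in the dial and the endpoints -/

/-- The clean piece gets WEAKER as the clean radius grows. [folklore] -/
theorem CleanTextureFloor.of_le {r r' : ℝ} (h : CleanTextureFloor r) (hle : r ≤ r') : CleanTextureFloor r' :=
  fun M z c hz hcl => h M z c hz (hcl.mono hle)

/-- The defective piece gets STRONGER as the radius grows (it is antitone). [folklore] -/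
theorem DefectiveCollarFloor.of_le {r r' : ℝ} (h : DefectiveCollarFloor r') (hle : r ≤ r') : DefectiveCollarFloor r :=
  fun M z c hz hn => h M z c hz fun hcl => hn (hcl.mono hle)

/-- Endpoint: at the members' radius the defective piece is EMPTY (admissible clusters are clean within `9/5`). [folklore] -/
theorem defectiveCollarFloor_members : DefectiveCollarFloor (9 / 5) :=
  fun _ _ _ hz hn => (hn (cleanBall_members hz)).elim

/-- … hence for every `r ≤ 9/5`. [folklore] -/
theorem defectiveCollarFloor_of_le_members {r : ℝ} (hr : r ≤ 9 / 5) : DefectiveCollarFloor r :=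
  defectiveCollarFloor_members.of_le hr

/-- Endpoint: at the members' radius the clean piece IS the target. [folklore] -/
theorem cleanTextureFloor_members_iff : CleanTextureFloor (9 / 5) ↔ StrainedPatchRec :=
  ⟨fun h => strainedPatchRec_of_clean_of_defective h defectiveCollarFloor_members, cleanTextureFloor_of_strainedPatch (9 / 5)⟩

/-! ## §4. The ladder: moving the dial costs exactly the annular piece -/

/-- **`AnnularDefectFloor r₁ r₂`** — the piece on clusters clean within `r₁` whose nearest non-clean site lies within `r₂`
(the defect sits in the annulus `r₁ < dist ≤ r₂`). -/
def AnnularDefectFloor (r₁ r₂ : ℝ) : Prop :=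
  ∀ (M : ℕ) (z : Fin M → E3) (c : Fin M), Admissible M z c → CleanBall r₁ z c → ¬CleanBall r₂ z c → 0 ≤ ballAvg (9 / 5) z (xRec M z) c

/-- ★ **LADDER, clean side**: `CleanTextureFloor r₁ ↔ CleanTextureFloor r₂ ∧ AnnularDefectFloor r₁ r₂` (`r₁ ≤ r₂`). [folklore] -/
theorem cleanTextureFloor_iff_annular {r₁ r₂ : ℝ} (hle : r₁ ≤ r₂) :
    CleanTextureFloor r₁ ↔ CleanTextureFloor r₂ ∧ AnnularDefectFloor r₁ r₂ := by
  refine ⟨fun h => ⟨h.of_le hle, fun M z c hz h₁ _ => h M z c hz h₁⟩, fun h M z c hz h₁ => ?_⟩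
  by_cases h₂ : CleanBall r₂ z c
  · exact h.1 M z c hz h₂
  · exact h.2 M z c hz h₁ h₂

/-- ★ **LADDER, defective side**: `DefectiveCollarFloor r₂ ↔ DefectiveCollarFloor r₁ ∧ AnnularDefectFloor r₁ r₂` (`r₁ ≤ r₂`). [folklore] -/
theorem defectiveCollarFloor_iff_annular {r₁ r₂ : ℝ} (hle : r₁ ≤ r₂) :
    DefectiveCollarFloor r₂ ↔ DefectiveCollarFloor r₁ ∧ AnnularDefectFloor r₁ r₂ := by
  refine ⟨fun h => ⟨h.of_le hle, fun M z c hz _ h₂ => h M z c hz h₂⟩, fun h M z c hz h₂ => ?_⟩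
  by_cases h₁ : CleanBall r₁ z c
  · exact h.2 M z c hz h₁ h₂
  · exact h.1 M z c hz h₁

/-- The whole defective piece at the record dial is the annulus over the members' ball:
`DefectiveCollarFloor r ↔ AnnularDefectFloor (9/5) r` (`9/5 ≤ r`). [folklore] -/
theorem defectiveCollarFloor_iff_annular_members {r : ℝ} (hr : 9 / 5 ≤ r) : DefectiveCollarFloor r ↔ AnnularDefectFloor (9 / 5) r :=
  ⟨fun h => ((defectiveCollarFloor_iff_annular hr).1 h).2, fun h => (defectiveCollarFloor_iff_annular hr).2 ⟨defectiveCollarFloor_members, h⟩⟩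

/-- Annular pieces compose along the ladder: `[r₁,r₂] ∧ [r₂,r₃] ⟹ [r₁,r₃]` (`r₁ ≤ r₂`). [folklore] -/
theorem AnnularDefectFloor.trans {r₁ r₂ r₃ : ℝ} (h₁₂ : AnnularDefectFloor r₁ r₂) (h₂₃ : AnnularDefectFloor r₂ r₃) (hle : r₁ ≤ r₂) :
    AnnularDefectFloor r₁ r₃ := by
  intro M z c hz h₁ h₃
  by_cases h₂ : CleanBall r₂ z c
  · exact h₂₃ M z c hz h₂ h₃
  · have := hle; exact h₁₂ M z c hz h₁ h₂

/-- An annular piece is WEAKER than the target. [folklore] -/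
theorem annularDefectFloor_of_strainedPatch (r₁ r₂ : ℝ) (h : StrainedPatchRec) : AnnularDefectFloor r₁ r₂ :=
  fun M z c hz _ _ => h M z c hz

/-- ★ **THREE REGIMES** (`r₁ ≤ r₂`): `StrainedPatchRec ↔ CleanTextureFloor r₂ ∧ AnnularDefectFloor r₁ r₂ ∧ DefectiveCollarFloor r₁` —
ELASTIC (clean out to `r₂`) ∧ FAR-DEFECT (clean core of radius `r₁`, nearest defect in the annulus) ∧ NEAR-DEFECT (a defect within `r₁`). [folklore] -/
theorem strainedPatchRec_iff_three_regimes {r₁ r₂ : ℝ} (hle : r₁ ≤ r₂) :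
    StrainedPatchRec ↔ CleanTextureFloor r₂ ∧ AnnularDefectFloor r₁ r₂ ∧ DefectiveCollarFloor r₁ := by
  rw [strainedPatchRec_iff_clean_and_defective r₂, defectiveCollarFloor_iff_annular hle]
  tauto

/-- ★ **THREE REGIMES, record dials** `r₁ = 24/5 = 9/5 + 3` (members + the Lennard-Jones core range of `W₄₅`: beyond it only the splice window
`3 ≤ r < 9/2`, `W₄₅ ∈ [V 3, 0)`, `|W₄₅| ≤ 2.3e-4`, reaches a member) and `r₂ = 63/10 = 9/5 + 9/2` (the domain of dependence of the functional):
`StrainedPatchRec ↔ CleanTextureFloor (63/10) ∧ AnnularDefectFloor (24/5) (63/10) ∧ DefectiveCollarFloor (24/5)`. [folklore] -/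
theorem strainedPatchRec_iff_record_regimes :
    StrainedPatchRec ↔ CleanTextureFloor (63 / 10) ∧ AnnularDefectFloor (24 / 5) (63 / 10) ∧ DefectiveCollarFloor (24 / 5) :=
  strainedPatchRec_iff_three_regimes (by norm_num)

/-! ## §5. Second layer under the clean piece: homogeneous floor ∧ clean-texture relief (GEN 43H re-hung) -/

/-- **`CleanTextureRelief r L B` [ANALYTIC; elastic linear response]** — every admissible cluster CLEAN within `r` is within `L·σ₁ + B` of SOME
admissible homogeneous instance (`TextureReliefBound L B` restricted to clean clusters). -/
def CleanTextureRelief (r L B : ℝ) : Prop :=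
  ∀ (M : ℕ) (z : Fin M → E3) (c : Fin M), Admissible M z c → CleanBall r z c →
    ∃ (M₀ : ℕ) (z₀ : Fin M₀ → E3) (c₀ : Fin M₀), Admissible M₀ z₀ c₀ ∧ IsHomBall (133 / 10) z₀ c₀ ∧
      ballAvg (9 / 5) z₀ (xRec M₀ z₀) c₀ - (L * sigmaOne + B) ≤ ballAvg (9 / 5) z (xRec M z) c

/-- ★ **SEAM under the clean piece**: `HomFloor m → CleanTextureRelief r L B → L·σ₁ + B ≤ m → CleanTextureFloor r`. [folklore: three lines] -/
theorem cleanTextureFloor_of_homFloor_of_cleanRelief {r m L B : ℝ} (hH : HomFloor m) (hR : CleanTextureRelief r L B)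
    (hm : L * sigmaOne + B ≤ m) : CleanTextureFloor r := by
  intro M z c hz hcl
  obtain ⟨M₀, z₀, c₀, h₀, hhom, hle⟩ := hR M z c hz hcl
  have hfloor := hH M₀ z₀ c₀ h₀ hhom
  linarith

/-- GEN 43H's (R) gives the clean relief at every dial (nothing is lost). [folklore] -/
theorem cleanTextureRelief_of_textureReliefBound (r : ℝ) {L B : ℝ} (h : TextureReliefBound L B) : CleanTextureRelief r L B :=
  fun M z c hz _ => h M z c hz

/-- The clean relief gets WEAKER as the clean radius grows. [folklore] -/
theorem CleanTextureRelief.of_le {r r' L B : ℝ} (h : CleanTextureRelief r L B) (hle : r ≤ r') : CleanTextureRelief r' L B :=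
  fun M z c hz hcl => h M z c hz (hcl.mono hle)

/-- The clean relief is monotone in the allowance. [folklore] -/
theorem CleanTextureRelief.mono {r L B L' B' : ℝ} (h : CleanTextureRelief r L B) (hle : L * sigmaOne + B ≤ L' * sigmaOne + B') :
    CleanTextureRelief r L' B' := by
  intro M z c hz hcl
  obtain ⟨M₀, z₀, c₀, h₀, hhom, hval⟩ := h M z c hz hcl
  exact ⟨M₀, z₀, c₀, h₀, hhom, by linarith⟩

/-- Where the clean relief sits: the clean piece plus ONE admissible homogeneous instance of value `≤ L·σ₁ + B` gives it back — it strengthens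
the CLEAN piece (not the target) exactly by the margin below the homogeneous floor. [folklore] -/
theorem cleanRelief_of_cleanFloor_of_witness {r L B : ℝ} (h : CleanTextureFloor r) {M₀ : ℕ} {z₀ : Fin M₀ → E3} {c₀ : Fin M₀}
    (h₀ : Admissible M₀ z₀ c₀) (hhom : IsHomBall (133 / 10) z₀ c₀) (hval : ballAvg (9 / 5) z₀ (xRec M₀ z₀) c₀ ≤ L * sigmaOne + B) :
    CleanTextureRelief r L B :=
  fun M z c hz hcl => ⟨M₀, z₀, c₀, h₀, hhom, by have := h M z c hz hcl; linarith⟩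

/-! ## §6. The node of record -/

/-- ★ **THREE-PIECE SEAM**: `HomFloor m ∧ CleanTextureRelief r L B ∧ (L·σ₁ + B ≤ m) ∧ DefectiveCollarFloor r ⟹ StrainedPatchRec`. [folklore] -/
theorem strainedPatchRec_of_homFloor_of_cleanRelief_of_defective {r m L B : ℝ} (hH : HomFloor m) (hR : CleanTextureRelief r L B)
    (hm : L * sigmaOne + B ≤ m) (hD : DefectiveCollarFloor r) : StrainedPatchRec :=
  strainedPatchRec_of_clean_of_defective (cleanTextureFloor_of_homFloor_of_cleanRelief hH hR hm) hD

/-- ★★ **THE NODE (record literals, record dial `r = 63/10 = 9/5 + 9/2`)**: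
`HomFloor (1/625) → CleanTextureRelief (63/10) (1/12) (1/4000) → DefectiveCollarFloor (63/10) → F1X∪T(0)` (the `h1` hypothesis of
`…CollarCensusZeroFree.aperiodicFrustratedLawGap_of_collarPiecesKK_milli_unionT_zero_free`; seam arithmetic `seam_arith`). -/
theorem strainedPatch_of_homFloor_625_of_cleanRelief_of_defective (hH : HomFloor (1 / 625))
    (hR : CleanTextureRelief (63 / 10) (1 / 12) (1 / 4000)) (hD : DefectiveCollarFloor (63 / 10)) :
    StrainedPatchMotifPricingCapXK (1 / 1000) (9 / 5) (133 / 10) (3 / 2) (effPot w₄₅ ω₄ (3 / 400)) (-(7175 / 10000) + 3 / 400)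
      (Collar (9 / 2) fun N y j => (∃ s : ℝ, 0 ≤ s ∧ s ≤ 3 / 2 ∧ NonEquilibriumCore (-(7175 / 10000)) 0 7 s (1 / 10000) N y j) ∨
        GoodAtScale (1 / 20) (3 / 2) y j) :=
  strainedPatch_iff.1 (strainedPatchRec_of_homFloor_of_cleanRelief_of_defective hH hR seam_arith hD)

/-- ★ **THE NODE, milli variant**: `HomFloor (1/1000) → CleanTextureRelief (63/10) (1/16) (1/4000) → DefectiveCollarFloor (63/10) → F1X∪T(0)`. -/
theorem strainedPatch_of_homFloor_milli_of_cleanRelief_of_defective (hH : HomFloor (1 / 1000))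
    (hR : CleanTextureRelief (63 / 10) (1 / 16) (1 / 4000)) (hD : DefectiveCollarFloor (63 / 10)) :
    StrainedPatchMotifPricingCapXK (1 / 1000) (9 / 5) (133 / 10) (3 / 2) (effPot w₄₅ ω₄ (3 / 400)) (-(7175 / 10000) + 3 / 400)
      (Collar (9 / 2) fun N y j => (∃ s : ℝ, 0 ≤ s ∧ s ≤ 3 / 2 ∧ NonEquilibriumCore (-(7175 / 10000)) 0 7 s (1 / 10000) N y j) ∨
        GoodAtScale (1 / 20) (3 / 2) y j) :=
  strainedPatch_iff.1 (strainedPatchRec_of_homFloor_of_cleanRelief_of_defective hH hR seam_arith_milli hD)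

/-- ★★ **THE NODE, three-regime form (record literals and dials)**:
`HomFloor (1/625) → CleanTextureRelief (63/10) (1/12) (1/4000) → AnnularDefectFloor (24/5) (63/10) → DefectiveCollarFloor (24/5) → F1X∪T(0)`. -/
theorem strainedPatch_of_homFloor_625_of_cleanRelief_of_annular_of_near (hH : HomFloor (1 / 625))
    (hR : CleanTextureRelief (63 / 10) (1 / 12) (1 / 4000)) (hA : AnnularDefectFloor (24 / 5) (63 / 10)) (hD : DefectiveCollarFloor (24 / 5)) :
    StrainedPatchMotifPricingCapXK (1 / 1000) (9 / 5) (133 / 10) (3 / 2) (effPot w₄₅ ω₄ (3 / 400)) (-(7175 / 10000) + 3 / 400)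
      (Collar (9 / 2) fun N y j => (∃ s : ℝ, 0 ≤ s ∧ s ≤ 3 / 2 ∧ NonEquilibriumCore (-(7175 / 10000)) 0 7 s (1 / 10000) N y j) ∨
        GoodAtScale (1 / 20) (3 / 2) y j) :=
  strainedPatch_of_homFloor_625_of_cleanRelief_of_defective hH hR
    ((defectiveCollarFloor_iff_annular (by norm_num : (24 : ℝ) / 5 ≤ 63 / 10)).2 ⟨hD, hA⟩)

/-- The two-piece node without the second layer (record dial): `CleanTextureFloor (63/10) → DefectiveCollarFloor (63/10) → F1X∪T(0)`. -/
theorem strainedPatch_of_clean_of_defective_record (hC : CleanTextureFloor (63 / 10)) (hD : DefectiveCollarFloor (63 / 10)) :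
    StrainedPatchMotifPricingCapXK (1 / 1000) (9 / 5) (133 / 10) (3 / 2) (effPot w₄₅ ω₄ (3 / 400)) (-(7175 / 10000) + 3 / 400)
      (Collar (9 / 2) fun N y j => (∃ s : ℝ, 0 ≤ s ∧ s ≤ 3 / 2 ∧ NonEquilibriumCore (-(7175 / 10000)) 0 7 s (1 / 10000) N y j) ∨
        GoodAtScale (1 / 20) (3 / 2) y j) :=
  strainedPatch_iff.1 (strainedPatchRec_of_clean_of_defective hC hD)

/-! ## §7. The bridge at the base range `R`: CORE functional ∧ TAIL budget (typed instruments; seam = linearity of the ball average)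

Beyond `R ≥ 24/5 = 9/5 + 3` of the centre a site reaches a member only through the splice window `3 ≤ r < 9/2` of `W₄₅`
(`W₄₅ = V·(1 − S₁((r−3)/(3/2))) ∈ [V 3, 0)`, `|W₄₅| ≤ |V 3| = 2.28e-4` per pair).  Splitting each member's `x_j` into the CORE part (pair terms with
sites within `R` of the centre) and the TAIL part `tailOut R` (pair terms with sites beyond `R`), the clean-core piece `CleanTextureFloor R`
(= ELASTIC ∧ FAR-DEFECT by the ladder) follows from a floor WITH MARGIN `μ` for the core functional on clean cores and a packing / window bound
`−μ` for the tail.  Record texture RD_jz0w52s (g45 `out/tailsplit_*.json`): tail beyond `24/5` = `−5.23e-4` (core part `2.344e-3`); hcp floor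
instance HZ00: `−5.22e-4` (core `2.597e-3`); fcc FZ00: `−6.84e-4` (core `4.082e-3`); beyond `5.55`: `−1.7e-5 / −1.7e-5 / −2.4e-5`. -/
/-- **`tailOut R M z c j`** — half the `W₄₅`-interaction of site `j` with the sites beyond radius `R` of the centre `z c` (the FAR pair terms). -/
noncomputable def tailOut (R : ℝ) (M : ℕ) (z : Fin M → E3) (c j : Fin M) : ℝ :=
  (∑ k : Fin M, if R < dist (z k) (z c) then effPot w₄₅ ω₄ (3 / 400) (dist (z j) (z k)) else 0) / 2
/-- **`CleanCoreFloor R μ` [ELASTIC, truncated functional; INSTRUMENTABLE like (H) ∧ clean relief]** — on admissible clusters clean within `R`,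
the members' ball average of the CORE functional `x_j − tailOut_j` is `≥ μ`. -/
def CleanCoreFloor (R μ : ℝ) : Prop :=
  ∀ (M : ℕ) (z : Fin M → E3) (c : Fin M), Admissible M z c → CleanBall R z c →
    μ ≤ ballAvg (9 / 5) z (fun j => xRec M z j - tailOut R M z c j) c
/-- **`TailPenalty R μ` [PACKING / window bound]** — on admissible clusters, the members' ball average of the far pair terms `tailOut R` is `≥ −μ`
(no cleanliness assumed: the same bound serves the defect side). -/
def TailPenalty (R μ : ℝ) : Prop :=
  ∀ (M : ℕ) (z : Fin M → E3) (c : Fin M), Admissible M z c → -μ ≤ ballAvg (9 / 5) z (tailOut R M z c) c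
/-- The ball average is additive in the site functional. [formal bookkeeping] -/
theorem ballAvg_add {ρ : ℝ} {M : ℕ} (z : Fin M → E3) (f g : Fin M → ℝ) (c : Fin M) :
    ballAvg ρ z (fun j => f j + g j) c = ballAvg ρ z f c + ballAvg ρ z g c := by
  unfold ballAvg
  rw [← Finset.sum_add_distrib]
  refine Finset.sum_congr rfl fun j _ => ?_
  rw [add_div]
/-- `x = (x − tail) + tail` inside the ball average. [formal bookkeeping] -/
theorem ballAvg_core_add_tail {R : ℝ} {M : ℕ} (z : Fin M → E3) (c : Fin M) :
    ballAvg (9 / 5) z (xRec M z) c =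
      ballAvg (9 / 5) z (fun j => xRec M z j - tailOut R M z c j) c + ballAvg (9 / 5) z (tailOut R M z c) c := by
  rw [← ballAvg_add]
  simp only [sub_add_cancel]
/-- ★ **BRIDGE SEAM at the base range**: `CleanCoreFloor R μ → TailPenalty R μ → CleanTextureFloor R`. [folklore: linearity + two inequalities] -/
theorem cleanTextureFloor_of_coreFloor_of_tailPenalty {R μ : ℝ} (hC : CleanCoreFloor R μ) (hT : TailPenalty R μ) : CleanTextureFloor R := by
  intro M z c hz hcl
  rw [ballAvg_core_add_tail (R := R) z c]
  have h₁ := hC M z c hz hcl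
  have h₂ := hT M z c hz
  linarith
/-- Where the core floor sits: the clean-core piece together with an UPPER bound `μ'` on the tail average over clean cores gives the core floor
back at level `−μ'` — so `CleanCoreFloor R μ` with `μ > 0` strengthens the clean-core piece by exactly `μ +` (the negative tail). [folklore] -/
theorem cleanCoreFloor_of_cleanFloor_of_tailUpper {R μ' : ℝ} (h : CleanTextureFloor R)
    (hup : ∀ (M : ℕ) (z : Fin M → E3) (c : Fin M), Admissible M z c → CleanBall R z c → ballAvg (9 / 5) z (tailOut R M z c) c ≤ μ') :
    CleanCoreFloor R (-μ') := by
  intro M z c hz hcl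
  have h₁ := h M z c hz hcl
  have h₂ := hup M z c hz hcl
  rw [ballAvg_core_add_tail (R := R) z c] at h₁
  linarith
/-- ★ **THE NODE, base-range form**: `CleanCoreFloor R μ → TailPenalty R μ → DefectiveCollarFloor R → StrainedPatchRec`. [folklore] -/
theorem strainedPatchRec_of_coreFloor_of_tailPenalty_of_near {R μ : ℝ} (hC : CleanCoreFloor R μ) (hT : TailPenalty R μ)
    (hD : DefectiveCollarFloor R) : StrainedPatchRec :=
  strainedPatchRec_of_clean_of_defective (cleanTextureFloor_of_coreFloor_of_tailPenalty hC hT) hD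
/-- ★★ **THE NODE, base-range record literals** `R = 24/5`, `μ = 1/1000` (float: core part of the record texture `2.344e-3`, of the hcp floor
instance `2.597e-3`; tail beyond `24/5` = `−5.2e-4`, so `TailPenalty (24/5) (1/1000)` tolerates a `1.9×` densification of the far annulus):
`CleanCoreFloor (24/5) (1/1000) → TailPenalty (24/5) (1/1000) → DefectiveCollarFloor (24/5) → F1X∪T(0)`. -/
theorem strainedPatch_of_coreFloor_milli_of_tailPenalty_of_near (hC : CleanCoreFloor (24 / 5) (1 / 1000)) (hT : TailPenalty (24 / 5) (1 / 1000))
    (hD : DefectiveCollarFloor (24 / 5)) :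
    StrainedPatchMotifPricingCapXK (1 / 1000) (9 / 5) (133 / 10) (3 / 2) (effPot w₄₅ ω₄ (3 / 400)) (-(7175 / 10000) + 3 / 400)
      (Collar (9 / 2) fun N y j => (∃ s : ℝ, 0 ≤ s ∧ s ≤ 3 / 2 ∧ NonEquilibriumCore (-(7175 / 10000)) 0 7 s (1 / 10000) N y j) ∨
        GoodAtScale (1 / 20) (3 / 2) y j) :=
  strainedPatch_iff.1 (strainedPatchRec_of_coreFloor_of_tailPenalty_of_near hC hT hD)
/-- The core floor is antitone in `μ`. [folklore] -/
theorem CleanCoreFloor.mono {R μ μ' : ℝ} (h : CleanCoreFloor R μ) (hle : μ' ≤ μ) : CleanCoreFloor R μ' :=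
  fun M z c hz hcl => hle.trans (h M z c hz hcl)
/-- The tail budget is monotone in `μ`. [folklore] -/
theorem TailPenalty.mono {R μ μ' : ℝ} (h : TailPenalty R μ) (hle : μ ≤ μ') : TailPenalty R μ' :=
  fun M z c hz => by have := h M z c hz; linarith

/-! ## §8. The geometric strengthening of the defect side: «admissibility forces a clean collar» (critic ROW 783 (3)(b), decidable form)
ROW 783 (3)(b) observed that every admissible end state of the basin search is a hop of the record texture family and proposed the GEOMETRIC
strengthening R2′ «`Admissible → NearHom ε`» (no energy) as the natural typed piece for the far class.  In this node's vocabulary the same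
move is `AdmissibleForcesClean r` : admissibility (members `1/8`-good and `1/20`-bad, every reach site `1/20`-bad, removal-stable, force-capped,
`Sep`, injective) already FORCES every site within `r` to be `1/8`-good — a purely geometric / defect-energetic statement with NO average in it,
LOCALLY DECIDABLE per configuration, and with no tube parameter `ε` to calibrate.  It makes the defect side at dial `r` VACUOUS
(`AdmissibleForcesClean r → DefectiveCollarFloor r`), so `CleanTextureFloor r ∧ AdmissibleForcesClean r → StrainedPatchRec`.  It is NOT weaker than
the target (it is a different, geometric claim) — filed as the OPTIONAL STRENGTHENING of NEAR-DEFECT, tagged UNDECIDED; census (a): no admissible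
state on file has a non-clean site within `63/10` (consistent with `AdmissibleForcesClean (63/10)`); the adversary is the same polytetrahedral seam. -/
/-- **`AdmissibleForcesClean r` [GEOMETRIC STRENGTHENING of the defect side; optional; UNDECIDED]** — every admissible cluster is clean within `r`. -/
def AdmissibleForcesClean (r : ℝ) : Prop :=
  ∀ (M : ℕ) (z : Fin M → E3) (c : Fin M), Admissible M z c → CleanBall r z c
/-- At the members' radius it holds by definition of admissibility. [formal bookkeeping] -/
theorem admissibleForcesClean_members : AdmissibleForcesClean (9 / 5) :=
  fun _M _z _c hz => cleanBall_members hz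
/-- It is antitone in the dial. [folklore] -/
theorem AdmissibleForcesClean.of_le {r r' : ℝ} (h : AdmissibleForcesClean r') (hle : r ≤ r') : AdmissibleForcesClean r :=
  fun M z c hz => (h M z c hz).mono hle
/-- The geometric strengthening makes the defect side vacuous. [folklore] -/
theorem defectiveCollarFloor_of_admissibleForcesClean {r : ℝ} (h : AdmissibleForcesClean r) : DefectiveCollarFloor r :=
  fun M z c hz hncl => absurd (h M z c hz) hncl
/-- … and the annulus above a forced-clean core is the whole defect side there: `AdmissibleForcesClean r₁ → AnnularDefectFloor r₁ r₂ → DefectiveCollarFloor r₂`. -/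
theorem defectiveCollarFloor_of_forcesClean_of_annular {r₁ r₂ : ℝ} (h : AdmissibleForcesClean r₁) (hA : AnnularDefectFloor r₁ r₂) :
    DefectiveCollarFloor r₂ :=
  fun M z c hz hncl => hA M z c hz (h M z c hz) hncl
/-- ★ `CleanTextureFloor r → AdmissibleForcesClean r → StrainedPatchRec` (elastic piece ∧ geometric strengthening). [folklore] -/
theorem strainedPatchRec_of_clean_of_forcesClean {r : ℝ} (hC : CleanTextureFloor r) (hG : AdmissibleForcesClean r) : StrainedPatchRec :=
  strainedPatchRec_of_clean_of_defective hC (defectiveCollarFloor_of_admissibleForcesClean hG)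
/-- Record form: `CleanTextureFloor (63/10) → AdmissibleForcesClean (24/5) → AnnularDefectFloor (24/5) (63/10) → StrainedPatchRec`
(ELASTIC ∧ «no admissible defect inside the base range» ∧ FAR-DEFECT). [folklore] -/
theorem strainedPatchRec_of_clean_of_forcesClean_of_annular (hC : CleanTextureFloor (63 / 10)) (hG : AdmissibleForcesClean (24 / 5))
    (hA : AnnularDefectFloor (24 / 5) (63 / 10)) : StrainedPatchRec :=
  strainedPatchRec_of_clean_of_defective hC (defectiveCollarFloor_of_forcesClean_of_annular hG hA)
end Summit.AtomisticToContinuum.Crystallization.Theorems.FrustratedLawDichotomyStrainedPatchCleanCollar
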